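import Summits.Ventures.Crystal3D.Theorems.StickyWulffConstantPolycrystalWulffBoundSubfamilyPerimeter
import Summits.Ventures.Crystal3D.Theorems.StickyWulffConstantPolycrystalWulffBoundDichotomyArith
import Summits.Ventures.Crystal3D.Theorems.StickyWulffConstantPolycrystalWulffBoundSeparated

/-!
# `PolycrystalWulffBound`, line `PolyDensity`: the fine twin-free rung with LATTICE-CLASS smallness

Route `StickyWulffConstant` of the venture `Summits/Ventures/Crystal3D`, crux `PolycrystalWulffBound`
(item `stmt-Ventures-19482`), second prover lane (poly-p2).  The planner's `rung_fineTwinFree`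
(P-LINE §3) asks every GRAIN to carry at most `3/10` of the volume and the grains to carry pairwise
distinct lattices; cf-p1 g17's note on that retype names the honest form: walls between grains of
the SAME point lattice may be free, so the smallness must hold PER LATTICE CLASS, «the class-volume
form ∀ f, |⋃{G_g : A_g Λ = A_f Λ}| ≤ 3/10·|E| follows by merging classes once interface additivity of
ι is in the tree».  This file proves exactly that form (`rung_fineTwinFree_classes`), in the crux's
`let` vocabulary (the binders `f g` of `TF` annotated `: Fin n`, same term): a finite POLYHEDRAL
twin-free texture (`TF`: co-axial frames carry the same lattice) each of whose LATTICE CLASSES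
`⋃ {G g : A g '' Λ = A f '' Λ}` carries at most `3/10` of the volume satisfies
`6·2^{1/3}·(√2·Vol)^{2/3} ≤ En` — no hypothesis on the lattices being distinct.

Proof: free part `≥ √3·Per(E)` (`freeEnergy_ge_mul_perimeter`); pairs in different classes are not
co-axial (by `TF`), hence generic (`m = 0`, charge `≥ 1`, body `B̄(0,1)`), pairs in one class
contribute `≥ 0`; so twice the wall energy dominates `Σ_{f,g in different classes} ι_B(G f, G g)`,
which by inclusion–exclusion (`per_biUnion_eq_sum_sub_sum_iota` per class, `sum_iota_eq_sum_per_sub_per`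
for the whole texture — the merging bookkeeping) equals `Σ_classes Per(⋃ class) − Per(E)`;
isoperimetry of `E` and of every merged class (`isoperimetric_toReal_three`); `fine_pincer_arith`
(gen 0) over the set of lattice classes.
WHAT THIS IS NOT: a registered stub; nothing on textures with a lattice class above `3/10` of the
volume or with twins; the crux is not claimed.
-/

noncomputable section

open scoped BigOperators InnerProductSpace ENNReal
open MeasureTheory Filter

namespace Summit.Ventures.Crystal3D.Cruxes.PolycrystalWulffBound.PolyDensity

open Summit.Ventures.Crystal3D.Theorems
open Summit.Ventures.Crystal3D.Cruxes.TextureLiminf.TexShadow (per polytope E3)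
open Literature.MathematicalPhysics.StatisticalMechanics (perimeter)

/-- **Fine twin-free textures with lattice-class smallness** (class-volume form of P-LINE §3's
`rung_fineTwinFree`): a polyhedral texture with `TF` whose lattice classes each carry at most `3/10`
of the volume satisfies the polycrystal Wulff bound. -/
theorem rung_fineTwinFree_classes :
    let Λ : Set (EuclideanSpace ℝ (Fin 3)) := Literature.MathematicalPhysics.StatisticalMechanics.fccStacking 1 (Real.sqrt (2 / 3));
    let Brl : (ℤ → ℤ) → Set (EuclideanSpace ℝ (Fin 3)) := Literature.MathematicalPhysics.StatisticalMechanics.barlowStacking 1 (Real.sqrt (2 / 3));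
    let Ax : EuclideanSpace ℝ (Fin 3) → (EuclideanSpace ℝ (Fin 3) ≃ₗᵢ[ℝ] EuclideanSpace ℝ (Fin 3)) → (EuclideanSpace ℝ (Fin 3) ≃ₗᵢ[ℝ] EuclideanSpace ℝ (Fin 3)) → Prop := fun m A B => ∃ (L : EuclideanSpace ℝ (Fin 3) ≃ₗᵢ[ℝ] EuclideanSpace ℝ (Fin 3)) (s₁ s₂ : EuclideanSpace ℝ (Fin 3)) (σ σ' : ℤ → ℤ), Literature.MathematicalPhysics.StatisticalMechanics.IsHaggSeq σ ∧ Literature.MathematicalPhysics.StatisticalMechanics.IsHaggSeq σ' ∧ L (EuclideanSpace.single (2 : Fin 3) (1 : ℝ)) = m ∧ A '' Λ ⊆ (fun q => L q + s₁) '' Brl σ ∧ B '' Λ ⊆ (fun q => L q + s₂) '' Brl σ';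
    let CoAx : (EuclideanSpace ℝ (Fin 3) ≃ₗᵢ[ℝ] EuclideanSpace ℝ (Fin 3)) → (EuclideanSpace ℝ (Fin 3) ≃ₗᵢ[ℝ] EuclideanSpace ℝ (Fin 3)) → Prop := fun A B => ∃ m, Ax m A B;
    let Φ : EuclideanSpace ℝ (Fin 3) → ℝ := fun ν => Real.sqrt 2 / 4 * ∑ᶠ w ∈ {w ∈ Λ | ‖w‖ = 1}, |⟪w, ν⟫_ℝ|;
    let Per : Set (EuclideanSpace ℝ (Fin 3)) → Set (EuclideanSpace ℝ (Fin 3)) → ℝ := fun K S => (⨆ (ξ : EuclideanSpace ℝ (Fin 3) → EuclideanSpace ℝ (Fin 3)) (_ : ContDiff ℝ 1 ξ ∧ HasCompactSupport ξ ∧ ∀ z, ξ z ∈ K), ENNReal.ofReal (∫ z in S, Literature.MathematicalPhysics.StatisticalMechanics.fieldDivergence ξ z)).toReal;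
    let ι : Set (EuclideanSpace ℝ (Fin 3)) → Set (EuclideanSpace ℝ (Fin 3)) → Set (EuclideanSpace ℝ (Fin 3)) → ℝ := fun K S₁ S₂ => (Per K S₁ + Per K S₂ - Per K (S₁ ∪ S₂)) / 2;
    let W : (EuclideanSpace ℝ (Fin 3) ≃ₗᵢ[ℝ] EuclideanSpace ℝ (Fin 3)) → Set (EuclideanSpace ℝ (Fin 3)) := fun A => {y | ∀ ν : EuclideanSpace ℝ (Fin 3), ⟪y, ν⟫_ℝ ≤ Φ (A.symm ν)};
    let Dsc : EuclideanSpace ℝ (Fin 3) → Set (EuclideanSpace ℝ (Fin 3)) := fun m => {y | ‖y‖ ≤ 1 ∧ ⟪y, m⟫_ℝ = 0};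
    let Tex : (n : ℕ) → (Fin n → Set (EuclideanSpace ℝ (Fin 3))) → (Fin n → (EuclideanSpace ℝ (Fin 3) ≃ₗᵢ[ℝ] EuclideanSpace ℝ (Fin 3))) → (Fin n → Fin n → ℝ) → (Fin n → Fin n → EuclideanSpace ℝ (Fin 3)) → Prop := fun n G A c m => (∀ f : Fin n, Literature.MathematicalPhysics.StatisticalMechanics.HasFinitePerimeter (G f) ∧ volume (G f) < ⊤) ∧ (∀ f g, f ≠ g → Disjoint (G f) (G g)) ∧ (∀ f g, f ≠ g → 0 ≤ c f g) ∧ (∀ f g, f ≠ g → ¬ CoAx (A f) (A g) → m f g = 0 ∧ 1 ≤ c f g) ∧ (∀ f g, f ≠ g → CoAx (A f) (A g) → A f '' Λ ≠ A g '' Λ → Ax (m f g) (A f) (A g) ∧ 1 / 2 ≤ c f g);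
    let En : (n : ℕ) → (Fin n → Set (EuclideanSpace ℝ (Fin 3))) → (Fin n → (EuclideanSpace ℝ (Fin 3) ≃ₗᵢ[ℝ] EuclideanSpace ℝ (Fin 3))) → (Fin n → Fin n → ℝ) → (Fin n → Fin n → EuclideanSpace ℝ (Fin 3)) → ℝ := fun n G A c m => ∑ f : Fin n, Per (W (A f)) (G f) - ∑ f, ∑ g, (if f = g then 0 else ι (W (A f)) (G f) (G g)) + ∑ f, ∑ g, (if f = g then 0 else c f g / 2 * ι (Dsc (m f g)) (G f) (G g));
    let Vol : (n : ℕ) → (Fin n → Set (EuclideanSpace ℝ (Fin 3))) → ℝ := fun n G => (volume (⋃ f : Fin n, G f)).toReal;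
    let Poly : Set (EuclideanSpace ℝ (Fin 3)) → Prop := fun S => ∃ (k : ℕ) (H : Fin k → Finset ((EuclideanSpace ℝ (Fin 3)) × ℝ)), S = ⋃ i, ⋂ p ∈ H i, {x | ⟪p.1, x⟫_ℝ < p.2};
    let TF : (n : ℕ) → (Fin n → (EuclideanSpace ℝ (Fin 3) ≃ₗᵢ[ℝ] EuclideanSpace ℝ (Fin 3))) → Prop := fun n A => ∀ f g : Fin n, f ≠ g → CoAx (A f) (A g) → A f '' Λ = A g '' Λ;
    ∀ (n : ℕ) (G : Fin n → Set (EuclideanSpace ℝ (Fin 3))) (A : Fin n → (EuclideanSpace ℝ (Fin 3) ≃ₗᵢ[ℝ] EuclideanSpace ℝ (Fin 3))) (c : Fin n → Fin n → ℝ) (m : Fin n → Fin n → EuclideanSpace ℝ (Fin 3)), Tex n G A c m → (∀ f, Poly (G f)) → TF n A → (∀ f, (volume (⋃ g ∈ {g : Fin n | A g '' Λ = A f '' Λ}, G g)).toReal ≤ 3 / 10 * Vol n G) → 6 * (2 : ℝ) ^ ((1 : ℝ) / 3) * (Real.sqrt 2 * Vol n G) ^ ((2 : ℝ) / 3) ≤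 En n G A c m  := by
  intro Λ Brl Ax CoAx Φ Per ι W Dsc Tex En Vol Poly TF n G A c m hTex hPoly hTF hsmall
  classical
  obtain ⟨hfin, hdisj, hc0, hgen, -⟩ := hTex
  have hvol : ∀ f, volume (G f) < ⊤ := fun f => (hfin f).2
  obtain ⟨hEm, hEv, hEp, hVsum⟩ := texture_union_facts G hfin hdisj
  -- lattice classes
  set lat : Fin n → Set E3 := fun f => A f '' Λ with hlat
  set L : Finset (Set E3) := Finset.univ.image lat with hL
  have hmaps : ∀ f ∈ (Finset.univ : Finset (Fin n)), lat f ∈ L := fun f _ =>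
    Finset.mem_image_of_mem lat (Finset.mem_univ f)
  -- pairs in different classes carry generic walls
  have hwall : ∀ f g, lat f ≠ lat g → m f g = 0 ∧ 1 ≤ c f g := by
    intro f g hne
    have hfg : f ≠ g := fun h => hne (h ▸ rfl)
    exact hgen f g hfg (fun hco => hne (hTF f g hfg hco))
  -- bodies
  have hDsc0 : Dsc 0 = Metric.closedBall (0 : E3) 1 := by
    show {y : E3 | ‖y‖ ≤ 1 ∧ ⟪y, (0 : E3)⟫_ℝ = 0} = Metric.closedBall 0 1
    ext y
    simp [inner_zero_right]
  have hBc : IsCompact (Metric.closedBall (0 : E3) 1) := isCompact_closedBall 0 1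
  have hBv : Convex ℝ (Metric.closedBall (0 : E3) 1) := convex_closedBall 0 1
  have hB0 : (0 : E3) ∈ Metric.closedBall (0 : E3) 1 := Metric.mem_closedBall_self zero_le_one
  have hBs : -Metric.closedBall (0 : E3) 1 = Metric.closedBall 0 1 := by
    rw [neg_closedBall, neg_zero]
  have hDc : ∀ v : E3, IsCompact (Dsc v) := fun v =>
    Metric.isCompact_of_isClosed_isBounded
      ((isClosed_le continuous_norm continuous_const).inter
        (isClosed_eq (continuous_id.inner continuous_const) continuous_const))
      (Metric.isBounded_closedBall.subset (cruxDisc_subset_closedBall v))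
  -- the free energy dominates `√3 · Per(E)`
  have hFr : Real.sqrt 3 * (perimeter (⋃ f, G f)).toReal ≤
      ∑ f, (Per (W (A f)) (G f) - ∑ g, (if f = g then 0 else ι (W (A f)) (G f) (G g))) :=
    freeEnergy_ge_mul_perimeter G hPoly hvol hdisj (fun f => W (A f))
      (fun f => isCompact_cruxWulffBody (A f)) (fun f => convex_cruxWulffBody (A f))
      (fun f => zero_mem_cruxWulffBody (A f)) (fun f => neg_cruxWulffBody_eq (A f))
      (Real.sqrt_pos.2 (by norm_num)) (fun f => closedBall_subset_cruxWulffBody (A f))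
  -- the unit-ball interface terms `w`, and their restriction to pairs in different classes
  set w : Fin n → Fin n → ℝ := fun f g => if f = g then 0 else
    (per (Metric.closedBall (0 : E3) 1) (G f) + per (Metric.closedBall (0 : E3) 1) (G g) -
      per (Metric.closedBall (0 : E3) 1) (G f ∪ G g)) / 2 with hw
  have hw0 : ∀ f g, 0 ≤ w f g := by
    intro f g
    by_cases hfg : f = g
    · simp only [hw, hfg, if_true]; exact le_rfl
    · simp only [hw, hfg, if_false]
      exact div_nonneg (iota_nonneg_of_poly G hPoly hvol hdisj hBc hBv hB0 hfg) zero_le_two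
  -- inclusion–exclusion: whole texture and each class
  have huniv : (∑ f, ∑ g, w f g) = (∑ f, per (Metric.closedBall (0 : E3) 1) (G f)) -
      per (Metric.closedBall (0 : E3) 1) (⋃ f, G f) :=
    sum_iota_eq_sum_per_sub_per G hPoly hvol hdisj hBc hBv hB0 hBs
  have hclass : ∀ ℓ, per (Metric.closedBall (0 : E3) 1)
      (⋃ f ∈ Finset.univ.filter (fun f => lat f = ℓ), G f) =
      (∑ f ∈ Finset.univ.filter (fun f => lat f = ℓ), per (Metric.closedBall (0 : E3) 1) (G f)) -
      ∑ f ∈ Finset.univ.filter (fun f => lat f = ℓ),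
        ∑ g ∈ Finset.univ.filter (fun f => lat f = ℓ), w f g :=
    fun ℓ => per_biUnion_eq_sum_sub_sum_iota G hPoly hvol hdisj hBc hBv hB0 hBs _
  -- the same-class part of `Σ w` in fiberwise form
  have hsame : (∑ ℓ ∈ L, ∑ f ∈ Finset.univ.filter (fun f => lat f = ℓ),
      ∑ g ∈ Finset.univ.filter (fun f => lat f = ℓ), w f g) =
      ∑ f, ∑ g, (if lat g = lat f then w f g else 0) := by
    rw [← Finset.sum_fiberwise_of_maps_to hmaps (fun f => ∑ g, (if lat g = lat f then w f g else 0))]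
    refine Finset.sum_congr rfl fun ℓ _ => Finset.sum_congr rfl fun f hf => ?_
    rw [(Finset.mem_filter.1 hf).2, Finset.sum_filter]
  -- merged-class perimeters minus Per(E) = the different-class interface terms
  have hD : (∑ ℓ ∈ L, per (Metric.closedBall (0 : E3) 1)
      (⋃ f ∈ Finset.univ.filter (fun f => lat f = ℓ), G f)) -
      per (Metric.closedBall (0 : E3) 1) (⋃ f, G f) =
      ∑ f, ∑ g, (if lat g = lat f then 0 else w f g) := by
    have h1 : (∑ ℓ ∈ L, per (Metric.closedBall (0 : E3) 1)
        (⋃ f ∈ Finset.univ.filter (fun f => lat f = ℓ), G f)) =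
        (∑ ℓ ∈ L, ∑ f ∈ Finset.univ.filter (fun f => lat f = ℓ),
          per (Metric.closedBall (0 : E3) 1) (G f)) -
        ∑ ℓ ∈ L, ∑ f ∈ Finset.univ.filter (fun f => lat f = ℓ),
          ∑ g ∈ Finset.univ.filter (fun f => lat f = ℓ), w f g := by
      rw [← Finset.sum_sub_distrib]
      exact Finset.sum_congr rfl fun ℓ _ => hclass ℓ
    rw [h1, Finset.sum_fiberwise_of_maps_to hmaps, hsame]
    have h2 : (∑ f, ∑ g, (if lat g = lat f then 0 else w f g)) =
        (∑ f, ∑ g, w f g) - ∑ f, ∑ g, (if lat g = lat f then w f g else 0) := by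
      rw [← Finset.sum_sub_distrib]
      refine Finset.sum_congr rfl fun f _ => ?_
      rw [← Finset.sum_sub_distrib]
      refine Finset.sum_congr rfl fun g _ => ?_
      split_ifs <;> ring
    rw [h2, huniv]
    ring
  -- the wall energy dominates the different-class interface terms
  have hterm : ∀ f g, (if lat g = lat f then 0 else w f g) ≤
      2 * (if f = g then 0 else c f g / 2 * ι (Dsc (m f g)) (G f) (G g)) := by
    intro f g
    by_cases hfg : f = g
    · rw [if_pos (by rw [hfg]), if_pos hfg, mul_zero]
    · rw [if_neg hfg]
      by_cases hl : lat g = lat f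
      · rw [if_pos hl]
        have hnn := iota_nonneg_of_poly G hPoly hvol hdisj (hDc (m f g)) (convex_cruxDisc (m f g))
          (zero_mem_cruxDisc (m f g)) hfg
        have hc := hc0 f g hfg
        show (0 : ℝ) ≤ 2 * (c f g / 2 * ((per (Dsc (m f g)) (G f) + per (Dsc (m f g)) (G g) -
          per (Dsc (m f g)) (G f ∪ G g)) / 2))
        have : 0 ≤ c f g * (per (Dsc (m f g)) (G f) + per (Dsc (m f g)) (G g) -
          per (Dsc (m f g)) (G f ∪ G g)) := mul_nonneg hc hnn
        linarith
      · rw [if_neg hl]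
        obtain ⟨hm, hc⟩ := hwall f g (fun h => hl h.symm)
        rw [hm, hDsc0]
        have hnn := iota_nonneg_of_poly G hPoly hvol hdisj hBc hBv hB0 hfg
        simp only [hw, hfg, if_false]
        show (per (Metric.closedBall (0 : E3) 1) (G f) + per (Metric.closedBall (0 : E3) 1) (G g) -
            per (Metric.closedBall (0 : E3) 1) (G f ∪ G g)) / 2 ≤
          2 * (c f g / 2 * ((per (Metric.closedBall (0 : E3) 1) (G f) +
            per (Metric.closedBall (0 : E3) 1) (G g) - per (Metric.closedBall (0 : E3) 1) (G f ∪ G g)) / 2))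
        nlinarith
  have hperB : ∀ S : Set E3, per (Metric.closedBall (0 : E3) 1) S = (perimeter S).toReal := fun S => by
    rw [per_closedBall_eq_mul_perimeter one_pos S, one_mul]
  have hbook : (∑ ℓ ∈ L, (perimeter (⋃ f ∈ Finset.univ.filter (fun f => lat f = ℓ), G f)).toReal) ≤
      (perimeter (⋃ f, G f)).toReal +
        2 * ∑ f, ∑ g, (if f = g then 0 else c f g / 2 * ι (Dsc (m f g)) (G f) (G g)) := by
    have hsum : (∑ f, ∑ g, (if lat g = lat f then 0 else w f g)) ≤
        ∑ f, ∑ g, 2 * (if f = g then 0 else c f g / 2 * ι (Dsc (m f g)) (G f) (G g)) :=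
      Finset.sum_le_sum fun f _ => Finset.sum_le_sum fun g _ => hterm f g
    rw [← hD] at hsum
    simp_rw [← Finset.mul_sum] at hsum
    rw [hperB, Finset.sum_congr rfl fun ℓ _ => hperB _] at hsum
    linarith
  -- volumes of the classes
  have hfacts : ∀ ℓ, MeasurableSet (⋃ f ∈ Finset.univ.filter (fun f => lat f = ℓ), G f) ∧
      volume (⋃ f ∈ Finset.univ.filter (fun f => lat f = ℓ), G f) < ⊤ ∧
      perimeter (⋃ f ∈ Finset.univ.filter (fun f => lat f = ℓ), G f) ≠ ⊤ ∧
      (volume (⋃ f ∈ Finset.univ.filter (fun f => lat f = ℓ), G f)).toReal =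
        ∑ f ∈ Finset.univ.filter (fun f => lat f = ℓ), (volume (G f)).toReal :=
    fun ℓ => subfamily_union_facts G hfin hdisj _
  have hV : Vol n G = ∑ ℓ ∈ L,
      (volume (⋃ f ∈ Finset.univ.filter (fun f => lat f = ℓ), G f)).toReal := by
    show (volume (⋃ f, G f)).toReal = _
    rw [hVsum, Finset.sum_congr rfl fun ℓ _ => (hfacts ℓ).2.2.2, Finset.sum_fiberwise_of_maps_to hmaps]
  have hsmallL : ∀ ℓ ∈ L, (volume (⋃ f ∈ Finset.univ.filter (fun f => lat f = ℓ), G f)).toReal ≤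
      3 / 10 * Vol n G := by
    intro ℓ hℓ
    obtain ⟨f₀, -, rfl⟩ := Finset.mem_image.1 hℓ
    have hset : (⋃ f ∈ Finset.univ.filter (fun f => lat f = lat f₀), G f) =
        ⋃ g ∈ {g : Fin n | A g '' Λ = A f₀ '' Λ}, G g := by
      ext x
      simp only [Set.mem_iUnion, Finset.mem_filter, Finset.mem_univ, true_and, Set.mem_setOf_eq,
        exists_prop, hlat]
    rw [hset]
    exact hsmall f₀
  -- isoperimetry of the union and of every class, and the pincer arithmetic
  have hiso := isoperimetric_toReal_three hEm hEv hEp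
  have hisoL : ∀ ℓ ∈ L, 3 * (Real.pi * 4 / 3) ^ ((1 : ℝ) / 3) *
      (volume (⋃ f ∈ Finset.univ.filter (fun f => lat f = ℓ), G f)).toReal ^ ((2 : ℝ) / 3) ≤
      (perimeter (⋃ f ∈ Finset.univ.filter (fun f => lat f = ℓ), G f)).toReal := fun ℓ _ =>
    isoperimetric_toReal_three (hfacts ℓ).1 (hfacts ℓ).2.1 (hfacts ℓ).2.2.1
  have harith := fine_pincer_arith L isoConst_three_pos (le_of_eq isoConst_three_cube.symm) hV
    (fun ℓ _ => ENNReal.toReal_nonneg) hsmallL hiso hisoL hbook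
  have hEn : En n G A c m =
      (∑ f, (Per (W (A f)) (G f) - ∑ g, (if f = g then 0 else ι (W (A f)) (G f) (G g)))) +
        ∑ f, ∑ g, (if f = g then 0 else c f g / 2 * ι (Dsc (m f g)) (G f) (G g)) := by
    show (∑ f, Per (W (A f)) (G f) -
        ∑ f, ∑ g, (if f = g then 0 else ι (W (A f)) (G f) (G g)) +
        ∑ f, ∑ g, (if f = g then 0 else c f g / 2 * ι (Dsc (m f g)) (G f) (G g))) =
      (∑ f, (Per (W (A f)) (G f) - ∑ g, (if f = g then 0 else ι (W (A f)) (G f) (G g)))) +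
        ∑ f, ∑ g, (if f = g then 0 else c f g / 2 * ι (Dsc (m f g)) (G f) (G g))
    rw [Finset.sum_sub_distrib]
  rw [hEn]
  exact harith.trans (by linarith)

end Summit.Ventures.Crystal3D.Cruxes.PolycrystalWulffBound.PolyDensity

end
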